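import Summits.CriticalPhenomena.CardyFormulaZ2.Theses.CardyRotToConf
import Literature.Probability.RandomPlanarGeometry.SLERangeNull
import HarnessLib

/-!
# The range of chordal SLE₆ is Lebesgue-null a.s. (line `germ-label-transport`, crux `stmt-CriticalPhenomena-0698`)

Stub `stub_sleRangeNull` of the fat-germ one-shot-surgery skeleton refuting
`Summit.CriticalPhenomena.CardyFormulaZ2.Theses.CardyRotToConf.CardyRotToConfR2SymmetryUpgrade`:
for every Dobrushin domain `D` and every chordal SLE₆ law `μ` of `D`, `μ`-a.e. curve class has a
trace of planar Lebesgue measure zero. It is the `κ = 6` case of the law-level theorem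
`IsSLELaw.ae_volume_range_eq_zero` (`Literature/Probability/RandomPlanarGeometry/SLERangeNull.lean`,
`4 < κ < 8`): every fixed point `w ≠ a, b` is a.s. avoided (Rohde–Schramm 2005, Thm. 6.4,
`IsSLELaw.ae_notMem_range`), `{a, b}` is Lebesgue-null, and Tonelli over the closed incidence set
`{(γ, w) | w ∈ trace γ} ⊆ CurveClass ℂ × ℂ` (`CurveClass.ae_measure_range_eq_zero`). In the
skeleton this makes every interior-tip conflict of the surgery's Markov kernel SLE₆-null
(`∂V ⊆ trace`, so a fat germ at an interior tip forces a trace of positive area).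
-/

noncomputable section

open MeasureTheory
open scoped NNReal

namespace Summit.CriticalPhenomena.CardyFormulaZ2.Theorems.CardyRotToConfR2SymmetryUpgrade

open Literature.Probability.RandomPlanarGeometry

/-- **The range of chordal SLE₆ is Lebesgue-null almost surely**: for every Dobrushin domain `D`
and every SLE₆ law `μ` of `D`, `volume (trace γ) = 0` for `μ`-a.e. curve class `γ` (each fixed
point `w ≠ a, b` is a.s. avoided, `IsSLELaw.ae_notMem_range`; Fubini/Tonelli over `w`,
`IsSLELaw.ae_volume_range_eq_zero` at `κ = 6`). [cite: RohdeSchramm2005, Thm 6.4] -/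
theorem stub_sleRangeNull :
    ∀ (D : DobrushinDomain) (μ : MeasureTheory.Measure (CurveClass ℂ)), IsSLELaw 6 D μ →
      ∀ᵐ γ ∂μ, MeasureTheory.volume γ.range = 0 :=
  fun _ _ hμ => hμ.ae_volume_range_eq_zero (by norm_num) (by norm_num)

end Summit.CriticalPhenomena.CardyFormulaZ2.Theorems.CardyRotToConfR2SymmetryUpgrade

end
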